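import Mathlib
import HarnessLib
import Summits.HubbardSuperconductivity.HubbardSuperconductivity.Theorems.KLProgrammeC4aBoxIntegralContinuity

/-!
# Route `KLProgramme` — crux C4a, S3 brick (B4) «(U1)-HYBRID» part U0: the box integral of the umklapp first-order layer with a CONFIGURATION-DEPENDENT
# loop numerator `X ϑ e v` is continuous in `ϑ` (hence interval-integrable, hence tiles sum)

Cell `gate-hubbard-kl`, seat hubbard-kl-k3c3-p3 (g36; row «implicit-function / monotonicity route for μ(n)»).  Located brick for the (C)-closer lane / the (M4)
assembly of the umklapp first-order ϑ-layer (stub (C) `stub_twoLeg_curvature` of `KLRegimeEngineV17F2`, stmt-HubbardSuperconductivity-20437), memo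
HOME/hubbard-kl-k3c3-p3/U1-CAUSTIC-SUP.md §19 «(U1)-NUMERATOR-ϑ» / «(U1)-HYBRID».

WHY.  The (U1) ladder (parts 6′/11′, `…C4aBoxDispatch` … `…C4aLoopCircleCanonical[MF]`) carries the loop numerator as `X e v`.  The numerator the first-order
co-moving jet delivers, `J(e,v+θ)·De_K(S(ϑ) − Φ(e,v+θ))[S′(ϑ)]` ((B3), `…C4aBubbleTubeDerivAll`), depends on the relative angle `ϑ` as well.  Every law of the chain is
per-`ϑ`, so the cure is a re-issue with `X : ℝ → ℝ → ℝ → ℝ` (`X ϑ e v`) and rows uniform in `ϑ`; this file is the re-issue of `…C4aBoxIntegralContinuity` §2: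
* `continuousOn_slice_of_continuousOn₃` — the per-`ϑ` joint continuity in `(e,v)` from joint continuity in `(ϑ,e,v)` (the row the per-`ϑ` laws consume);
* **`continuous_boxIntegral_cfg`**, `continuous_boxAbsIntegral_cfg`, `boxAbsIntegral_intervalIntegrable_cfg`, **`boxAbsIntegral_le_card_mul_of_tiling_cfg`** —
  `ϑ ↦ ∫_{−hi}^{hi}∫_{φa}^{φb} w(e)·(X(ϑ,e,v)·(K e)′(e_K(S(ϑ) − Φ(e,v+θ)))) dv de` is continuous for `X` jointly continuous on `ℝ × [−hi,hi] × ℝ`, `∂ᵤK` jointly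
  continuous, `w` continuous on `[−hi,hi]`; hence `|·|` is interval-integrable on every `ϑ`-interval and the equal-tiling sum needs no integrability row.
Pure bookkeeping (`continuous_clampedBoxIntegral` + the clamp `e ↦ max(−hi, min e hi)`); nothing about the model's sizes; nothing asserts (C), K3 or superconductivity.
References: FST II CPAM 51 (1998) §3 [cite: FeldmanSalmhoferTrubowitz1998]; BGM 2006 §2.4 [cite: BenfattoGiulianiMastropietro2006].
-/

noncomputable section

namespace Summit.HubbardSuperconductivity.HubbardSuperconductivity.Theorems.C4a

set_option linter.dupNamespace false -- summit = problem name (single-conjunct summit), D-0017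

open Real Set MeasureTheory intervalIntegral
open scoped Interval
open Literature.MathematicalPhysics.QuantumLattice Literature.MathematicalPhysics.QuantumLattice.BandSectorCounting
open Literature.MathematicalPhysics.QuantumLattice.FermiRG
open Summit.HubbardSuperconductivity.HubbardSuperconductivity.Theorems.KLRegimeSplit
open Summit.HubbardSuperconductivity.HubbardSuperconductivity.Theorems.DispersionFlow
open Summit.HubbardSuperconductivity.HubbardSuperconductivity.Theorems.PerturbedFermiCurve

/-! ## The box integral of the chain with a configuration-dependent numerator -/

section Sizes

variable {K : TrigPolyC4v} {A : ℝ} (hA : ∀ p : Momentum, ∀ j ≤ 2, ‖iteratedFDeriv ℝ j (frameShift K) p‖ ≤ A)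
  (hd : klCurveD ≤ (bandBounds (show (-4 : ℝ) < -1.1 by norm_num) (show (-1.1 : ℝ) ≤ -0.1 by norm_num)
    (show (-0.1 : ℝ) < 0 by norm_num)).Dtmin - 2 * A)
  {μ r : ℝ} (hlo : (-1.1 : ℝ) < μ - r - A) (hhi : μ + r + A < -0.1)
include hA hd hlo hhi

omit hA hd hlo hhi in
/-- **Per-`ϑ` joint continuity from joint continuity in `(ϑ, e, v)`**: the row shape the per-`ϑ` laws of the chain consume. [folklore] -/
theorem continuousOn_slice_of_continuousOn₃ {hi : ℝ} {X : ℝ → ℝ → ℝ → ℝ}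
    (hX3 : ContinuousOn (fun p : ℝ × ℝ × ℝ => X p.1 p.2.1 p.2.2) (univ ×ˢ (Icc (-hi) hi ×ˢ univ))) (ϑ : ℝ) :
    ContinuousOn (fun p : ℝ × ℝ => X ϑ p.1 p.2) (Icc (-hi) hi ×ˢ univ) := by
  have hf : Continuous fun p : ℝ × ℝ => ((ϑ, p) : ℝ × ℝ × ℝ) := continuous_const.prodMk continuous_id
  exact hX3.comp hf.continuousOn fun p hp => mem_prod.2 ⟨mem_univ _, hp⟩

/-- **THE SIGNED BOX INTEGRAL IS CONTINUOUS IN `ϑ` (configuration-dependent numerator)**: `0 ≤ hi < r`, `|ρ| < r`; `X` jointly continuous on `ℝ × [−hi,hi] × ℝ`, `∂ᵤK` jointly continuous, `w` continuous on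
`[−hi,hi]` ⟹ `ϑ ↦ ∫_{−hi..hi}∫_{φa..φb} w(e)·(X(ϑ,e,v)·(K e)′(e_K(S(ϑ) − Φ(e,v+θ)))) dv de` is continuous. -/
theorem continuous_boxIntegral_cfg {ρ : ℝ} (hρ : |ρ| < r) (θ : ℝ) {φa φb hi : ℝ} (hhi0 : 0 ≤ hi) (hhir : hi < r) {Kr : ℝ → ℝ → ℝ} {X : ℝ → ℝ → ℝ → ℝ} {wt : ℝ → ℝ}
    (hX3 : ContinuousOn (fun p : ℝ × ℝ × ℝ => X p.1 p.2.1 p.2.2) (univ ×ˢ (Icc (-hi) hi ×ˢ univ))) (hKc : Continuous fun p : ℝ × ℝ => deriv (Kr p.1) p.2)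
    (hwc : ContinuousOn wt (Icc (-hi) hi)) :
    Continuous fun ϑ : ℝ => ∫ e in (-hi)..hi, ∫ v in φa..φb,
      wt e * (X ϑ e v * deriv (Kr e) (frameLevel μ K (pairSumPath μ K ρ ϑ θ 0 - levelPoint μ K e (v + θ)))) := by
  set B := bandBounds (show (-4 : ℝ) < -1.1 by norm_num) (show (-1.1 : ℝ) ≤ -0.1 by norm_num) (show (-0.1 : ℝ) < 0 by norm_num) with hBdef
  have hADt : 2 * A < B.Dtmin := by have := klCurveD_pos; linarith only [this, hd]
  have hlev : ContinuousOn (fun p : ℝ × ℝ => levelPoint μ K p.1 p.2) ({x : ℝ | |x| < r} ×ˢ univ) :=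
    (contDiffOn_levelPoint B hA hADt hlo hhi (m := 0)).continuousOn
  have hfl : Continuous (frameLevel μ K) := (EngineV8.contDiff_frameLevel μ K (n := 0)).continuous
  have hS : Continuous fun ϑ : ℝ => pairSumPath μ K ρ ϑ θ 0 := continuous_pairSumPath_angle hA hd hlo hhi hρ θ
  have hhh : -hi ≤ hi := by linarith only [hhi0]
  -- the clamp of the loop level, as a function of `q = (ϑ, (e, v))`
  have hcl : Continuous fun q : ℝ × (ℝ × ℝ) => max (-hi) (min q.2.1 hi) :=
    continuous_const.max ((continuous_fst.comp continuous_snd).min continuous_const)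
  have hclI : ∀ q : ℝ × (ℝ × ℝ), max (-hi) (min q.2.1 hi) ∈ Icc (-hi) hi := fun q => ⟨le_max_left _ _, max_le hhh (min_le_right _ _)⟩
  have hclr : ∀ q : ℝ × (ℝ × ℝ), |max (-hi) (min q.2.1 hi)| < r := fun q =>
    abs_lt.2 ⟨by linarith only [(hclI q).1, hhir], lt_of_le_of_lt (hclI q).2 hhir⟩
  -- the factors, composed without expected types
  have hw := hwc.comp_continuous (f := fun q : ℝ × (ℝ × ℝ) => max (-hi) (min q.2.1 hi)) hcl fun q => hclI q
  have hXc := hX3.comp_continuous (f := fun q : ℝ × (ℝ × ℝ) => ((q.1, (max (-hi) (min q.2.1 hi), q.2.2)) : ℝ × ℝ × ℝ))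
    (continuous_fst.prodMk (hcl.prodMk (continuous_snd.comp continuous_snd))) fun q => mem_prod.2 ⟨mem_univ _, mem_prod.2 ⟨hclI q, mem_univ _⟩⟩
  have hL := hlev.comp_continuous (f := fun q : ℝ × (ℝ × ℝ) => ((max (-hi) (min q.2.1 hi), q.2.2 + θ) : ℝ × ℝ))
    (hcl.prodMk ((continuous_snd.comp continuous_snd).add continuous_const)) fun q => mem_prod.2 ⟨hclr q, mem_univ _⟩
  have hL' : Continuous fun q : ℝ × (ℝ × ℝ) => levelPoint μ K (max (-hi) (min q.2.1 hi)) (q.2.2 + θ) := hL.congr fun _ => rfl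
  have hSq : Continuous fun q : ℝ × (ℝ × ℝ) => pairSumPath μ K ρ q.1 θ 0 := hS.comp continuous_fst
  have hband := hfl.comp (hSq.sub hL')
  have hband' : Continuous fun q : ℝ × (ℝ × ℝ) => frameLevel μ K (pairSumPath μ K ρ q.1 θ 0 - levelPoint μ K (max (-hi) (min q.2.1 hi)) (q.2.2 + θ)) :=
    hband.congr fun _ => rfl
  have hK := hKc.comp (hcl.prodMk hband')
  have hK' : Continuous fun q : ℝ × (ℝ × ℝ) =>
      deriv (Kr (max (-hi) (min q.2.1 hi))) (frameLevel μ K (pairSumPath μ K ρ q.1 θ 0 - levelPoint μ K (max (-hi) (min q.2.1 hi)) (q.2.2 + θ))) :=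
    hK.congr fun _ => rfl
  have hw' : Continuous fun q : ℝ × (ℝ × ℝ) => wt (max (-hi) (min q.2.1 hi)) := hw.congr fun _ => rfl
  have hXc' : Continuous fun q : ℝ × (ℝ × ℝ) => X q.1 (max (-hi) (min q.2.1 hi)) q.2.2 := hXc.congr fun _ => rfl
  have hG : Continuous fun q : ℝ × (ℝ × ℝ) => wt (max (-hi) (min q.2.1 hi)) * (X q.1 (max (-hi) (min q.2.1 hi)) q.2.2 *
      deriv (Kr (max (-hi) (min q.2.1 hi))) (frameLevel μ K (pairSumPath μ K ρ q.1 θ 0 - levelPoint μ K (max (-hi) (min q.2.1 hi)) (q.2.2 + θ)))) :=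
    hw'.mul (hXc'.mul hK')
  have hint := continuous_clampedBoxIntegral hG (-hi) hi φa φb
  -- remove the clamp on the integration range
  refine hint.congr fun ϑ => ?_
  exact intervalIntegral_comp_clamp (f := fun e => ∫ v in φa..φb,
    wt e * (X ϑ e v * deriv (Kr e) (frameLevel μ K (pairSumPath μ K ρ ϑ θ 0 - levelPoint μ K e (v + θ))))) hhh

/-- **`F(ϑ) = |box integral|` IS CONTINUOUS IN `ϑ`.** -/
theorem continuous_boxAbsIntegral_cfg {ρ : ℝ} (hρ : |ρ| < r) (θ : ℝ) {φa φb hi : ℝ} (hhi0 : 0 ≤ hi) (hhir : hi < r) {Kr : ℝ → ℝ → ℝ} {X : ℝ → ℝ → ℝ → ℝ} {wt : ℝ → ℝ}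
    (hX3 : ContinuousOn (fun p : ℝ × ℝ × ℝ => X p.1 p.2.1 p.2.2) (univ ×ˢ (Icc (-hi) hi ×ˢ univ))) (hKc : Continuous fun p : ℝ × ℝ => deriv (Kr p.1) p.2)
    (hwc : ContinuousOn wt (Icc (-hi) hi)) :
    Continuous fun ϑ : ℝ => |∫ e in (-hi)..hi, ∫ v in φa..φb,
      wt e * (X ϑ e v * deriv (Kr e) (frameLevel μ K (pairSumPath μ K ρ ϑ θ 0 - levelPoint μ K e (v + θ))))| :=
  continuous_abs.comp (continuous_boxIntegral_cfg hA hd hlo hhi hρ θ hhi0 hhir hX3 hKc hwc)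

/-- **`F(ϑ) = |box integral|` IS INTERVAL-INTEGRABLE** on every `ϑ`-interval `[a, b]`. -/
theorem boxAbsIntegral_intervalIntegrable_cfg {ρ : ℝ} (hρ : |ρ| < r) (θ : ℝ) {φa φb hi : ℝ} (hhi0 : 0 ≤ hi) (hhir : hi < r) {Kr : ℝ → ℝ → ℝ} {X : ℝ → ℝ → ℝ → ℝ}
    {wt : ℝ → ℝ} (hX3 : ContinuousOn (fun p : ℝ × ℝ × ℝ => X p.1 p.2.1 p.2.2) (univ ×ˢ (Icc (-hi) hi ×ˢ univ))) (hKc : Continuous fun p : ℝ × ℝ => deriv (Kr p.1) p.2)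
    (hwc : ContinuousOn wt (Icc (-hi) hi)) (a b : ℝ) :
    IntervalIntegrable (fun ϑ : ℝ => |∫ e in (-hi)..hi, ∫ v in φa..φb,
      wt e * (X ϑ e v * deriv (Kr e) (frameLevel μ K (pairSumPath μ K ρ ϑ θ 0 - levelPoint μ K e (v + θ))))|) volume a b :=
  (continuous_boxAbsIntegral_cfg hA hd hlo hhi hρ θ hhi0 hhir hX3 hKc hwc).intervalIntegrable a b

/-- **THE TILING SUM FOR THE BOX INTEGRAL, NO INTEGRABILITY ROW**: `0 ≤ ω`; on each tile `[a + kω, a + (k+1)ω]`, `k < N`, `∫ F ≤ b` ⟹ `∫_a^{a+Nω} F ≤ N·b`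
(`…C4aCausticWindowTiling.intervalIntegral_le_card_mul_of_tiling_of_integrable` with `boxAbsIntegral_intervalIntegrable_cfg`). -/
theorem boxAbsIntegral_le_card_mul_of_tiling_cfg {ρ : ℝ} (hρ : |ρ| < r) (θ : ℝ) {φa φb hi : ℝ} (hhi0 : 0 ≤ hi) (hhir : hi < r) {Kr : ℝ → ℝ → ℝ} {X : ℝ → ℝ → ℝ → ℝ}
    {wt : ℝ → ℝ} (hX3 : ContinuousOn (fun p : ℝ × ℝ × ℝ => X p.1 p.2.1 p.2.2) (univ ×ˢ (Icc (-hi) hi ×ˢ univ))) (hKc : Continuous fun p : ℝ × ℝ => deriv (Kr p.1) p.2)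
    (hwc : ContinuousOn wt (Icc (-hi) hi)) {a ω b : ℝ} {N : ℕ} (hω : 0 ≤ ω)
    (hb : ∀ k : ℕ, k < N → ∫ ϑ in (a + k * ω)..(a + (k + 1 : ℕ) * ω), |∫ e in (-hi)..hi, ∫ v in φa..φb,
      wt e * (X ϑ e v * deriv (Kr e) (frameLevel μ K (pairSumPath μ K ρ ϑ θ 0 - levelPoint μ K e (v + θ))))| ≤ b) :
    ∫ ϑ in a..(a + N * ω), |∫ e in (-hi)..hi, ∫ v in φa..φb,
      wt e * (X ϑ e v * deriv (Kr e) (frameLevel μ K (pairSumPath μ K ρ ϑ θ 0 - levelPoint μ K e (v + θ))))| ≤ N * b :=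
  intervalIntegral_le_card_mul_of_tiling_of_integrable hω (boxAbsIntegral_intervalIntegrable_cfg hA hd hlo hhi hρ θ hhi0 hhir hX3 hKc hwc _ _) hb

end Sizes

end Summit.HubbardSuperconductivity.HubbardSuperconductivity.Theorems.C4a

end
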